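import Literature.Computability.Cryptography.GoldreichLevinInverter
import Literature.Computability.Cryptography.LiuPassLemma53HidingMain
import HarnessLib

/-!
# The Goldreich–Levin theorem for hiding functions (fixed output length): the contradiction

Crypto layer, part 4, completing the proof of `goldreichLevin_hiding_len`
(`GoldreichLevinHidingLen.lean`) modulo the efficiency of the inverter (`GLInv.glInvRun_polyTime`,
named fact, discharged by the `FP` program of the sequel): `goldreichLevin_hiding_len_of_eff`.

Given a PPT distinguisher `D` of `{g(x‖ρ) ‖ σ ‖ GL(x,σ)}` from `{g(x‖ρ) ‖ σ ‖ U}` with advantage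
`≥ 1/n^c` infinitely often, the inverter `𝒜_GL` (`GoldreichLevinInverter.lean`, with `e = c + d`)
run with the coin budget `clGL` — which carries `D`'s coin count `κ = D.coinLen(L_in)` as advice
at a sparse sequence of good levels (`Yao.seqN`, exactly as in `YaoAmplification.lean` and
`LiuPassLemma53HidingMain.lean`), assigned only at the exact input length `2n + 2 + ℓ_g(n)` so that
it stays polynomially bounded whatever `ℓ_g` is — is PPT and recovers `x ← S_n` with probability
`≥ 1/n^{3e+2}` at those levels (`hidingProb_ge`), contradicting `IsHidingOver g S m`.

## References

* O. Goldreich, L. Levin, *A hard-core predicate for all one-way functions*, STOC 1989.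
* O. Goldreich, *Foundations of Cryptography I*, CUP 2001, Thm 2.5.6.
* Y. Liu, R. Pass, *On one-way functions and Kolmogorov complexity*, FOCS 2020
  (arXiv:2009.11514), Appendix, Thm [GL89].
-/

namespace Literature.Computability.Cryptography

open Finset Filter Asymptotics _root_.Computability Complexity Polynomial

namespace GLInv

variable (D : RandAlg (List Bool) Bool) (qD : Polynomial ℕ) (d e : ℕ) (ℓg : ℕ → ℕ)

/-! ### The coin budget -/

/-- `D`'s coin count at level `n`. [folklore] -/
def κA (n : ℕ) : ℕ := D.coinLen (Lin d n (ℓg n))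

/-- The room for the coin fields besides `D`'s coins: `2 + 2K + Kn + kn + k`. [folklore] -/
def Room (n : ℕ) : ℕ := 2 + 2 * Kof d n + Kof d n * n + kof e n * n + kof e n

/-- **The coin count encoding the advice** `κ`: `κ + K_b · Room`. [folklore] -/
def Code (n : ℕ) : ℕ := κA D d ℓg n + Kb qD d n (ℓg n) * Room d e n

/-- The input length `2n + 2 + ℓ_g(n)` of `𝒜_GL` at level `n` (also the spread of the selection). [folklore] -/
def wlen (n : ℕ) : ℕ := 2 * n + 2 + ℓg n

/-- **The coin budget of `𝒜_GL`**: `Code n` at the exact input length of a selected level `n`,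
`0` elsewhere. [folklore] -/
noncomputable def clGL (Gs : ℕ → Prop) (l : ℕ) : ℕ :=
  if Yao.sel Gs (wlen ℓg) l ≤ l ∧ l = wlen ℓg (Yao.sel Gs (wlen ℓg) l) then Code D qD d e ℓg (Yao.sel Gs (wlen ℓg) l) else 0

/-- A polynomial bound on the coin budget, in the input length `l` (`n, K ≤ d·l`, `L_in ≤ l + d l² + d l`). [folklore] -/
noncomputable def clPolyGL : Polynomial ℕ :=
  (qD.comp (X + C d * X ^ 2 + C d * X) + 1) *
    (1 + (C 2 + C (2 * d) * X + C d * X ^ 2 + C (2 * e + 3) * X ^ 2 + C (2 * e + 3) * X))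

variable {D qD d e ℓg}

/-- `n ≤ wlen n`. [folklore] -/
theorem wlen_ge (n : ℕ) : n ≤ wlen ℓg n := by unfold wlen; omega

/-- `K ≤ d·n`. [folklore] -/
theorem Kof_le (d n : ℕ) : Kof d n ≤ d * n := Nat.mul_le_mul_left d (Nat.log_le_self 2 n)

/-- `k ≤ (2e+3)·n` for `n ≥ 1`. [folklore] -/
theorem kof_le {n : ℕ} (hn : 1 ≤ n) (e : ℕ) : kof e n ≤ (2 * e + 3) * n := by
  unfold kof
  have : Nat.log 2 n < n := Nat.log_lt_self 2 (by omega)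
  have h1 : (2 * e + 1) * (Nat.log 2 n + 1) ≤ (2 * e + 1) * n := Nat.mul_le_mul_left _ this
  nlinarith

/-- `κ(n) < K_b(n)` for a bound `q_D` on `D`'s coin count. [folklore] -/
theorem κA_lt (hqD : ∀ l, D.coinLen l ≤ qD.eval l) (n : ℕ) : κA D d ℓg n < Kb qD d n (ℓg n) := by
  unfold κA Kb; exact Nat.lt_succ_of_le (hqD _)

/-- **The coin budget is polynomially bounded** (in the input length), when the good levels are
unbounded and positive. [folklore] -/
theorem clGL_le (hqD : ∀ l, D.coinLen l ≤ qD.eval l) {Gs : ℕ → Prop} (hG : ∀ a, ∃ b, a ≤ b ∧ Gs b) (hG1 : ∀ n, Gs n → 1 ≤ n)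
    (l : ℕ) : clGL D qD d e ℓg Gs l ≤ (clPolyGL qD d e).eval l := by
  unfold clGL
  split_ifs with h
  · obtain ⟨hnl, hl⟩ := h
    set n := Yao.sel Gs (wlen ℓg) l with hn
    have hpos : 1 ≤ n := hG1 n (Yao.seqN_good hG _)
    have hK := Kof_le d n
    have hk := kof_le hpos e
    have hKn : Kof d n * n ≤ d * l ^ 2 := by
      calc Kof d n * n ≤ d * n * n := Nat.mul_le_mul_right _ hK
        _ ≤ d * l * l := Nat.mul_le_mul (Nat.mul_le_mul_left _ hnl) hnl
        _ = d * l ^ 2 := by ring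
    have hKl : Kof d n ≤ d * l := hK.trans (Nat.mul_le_mul_left _ hnl)
    have hLinEq : Lin d n (ℓg n) = l + Kof d n * n + Kof d n := by
      unfold Lin; rw [hl]; unfold wlen; ring
    have hLin : Lin d n (ℓg n) ≤ l + d * l ^ 2 + d * l := by rw [hLinEq]; omega
    have hKb : Kb qD d n (ℓg n) ≤ qD.eval (l + d * l ^ 2 + d * l) + 1 := Nat.succ_le_succ (TM2Iter.eval_mono qD hLin)
    have hκ : κA D d ℓg n ≤ qD.eval (l + d * l ^ 2 + d * l) + 1 := ((κA_lt hqD n).le).trans hKb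
    have hRoom : Room d e n ≤ 2 + 2 * d * l + d * l ^ 2 + (2 * e + 3) * l ^ 2 + (2 * e + 3) * l := by
      unfold Room
      have h3 : kof e n * n ≤ (2 * e + 3) * l ^ 2 := by
        calc kof e n * n ≤ (2 * e + 3) * n * n := Nat.mul_le_mul_right _ hk
          _ ≤ (2 * e + 3) * l * l := Nat.mul_le_mul (Nat.mul_le_mul_left _ hnl) hnl
          _ = (2 * e + 3) * l ^ 2 := by ring
      have h4 : kof e n ≤ (2 * e + 3) * l := hk.trans (Nat.mul_le_mul_left _ hnl)
      have h1 : 2 * Kof d n ≤ 2 * d * l := by rw [mul_assoc]; exact Nat.mul_le_mul_left 2 hKl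
      omega
    have hev : (clPolyGL qD d e).eval l = (qD.eval (l + d * l ^ 2 + d * l) + 1) *
        (1 + (2 + 2 * d * l + d * l ^ 2 + (2 * e + 3) * l ^ 2 + (2 * e + 3) * l)) := by
      simp [clPolyGL, eval_comp]
    rw [hev]
    unfold Code
    calc κA D d ℓg n + Kb qD d n (ℓg n) * Room d e n
        ≤ (qD.eval (l + d * l ^ 2 + d * l) + 1) + (qD.eval (l + d * l ^ 2 + d * l) + 1) * (2 + 2 * d * l + d * l ^ 2 + (2 * e + 3) * l ^ 2 + (2 * e + 3) * l) :=
          Nat.add_le_add hκ (Nat.mul_le_mul hKb hRoom)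
      _ = (qD.eval (l + d * l ^ 2 + d * l) + 1) * (1 + (2 + 2 * d * l + d * l ^ 2 + (2 * e + 3) * l ^ 2 + (2 * e + 3) * l)) := by ring
  · exact Nat.zero_le _

/-- **At the input length of a selected level the budget is `Code n`.** [folklore] -/
theorem clGL_eq {Gs : ℕ → Prop} (hG : ∀ a, ∃ b, a ≤ b ∧ Gs b) (j : ℕ) :
    clGL D qD d e ℓg Gs (wlen ℓg (Yao.seqN Gs (wlen ℓg) j)) = Code D qD d e ℓg (Yao.seqN Gs (wlen ℓg) j) := by
  set n := Yao.seqN Gs (wlen ℓg) j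
  have hsel : Yao.sel Gs (wlen ℓg) (wlen ℓg n) = n := Yao.sel_eq hG wlen_ge (wlen_ge n) le_rfl
  unfold clGL
  rw [hsel, if_pos ⟨wlen_ge n, rfl⟩]

/-- `Code n` has the shape required by `hidingProb_ge`: `1 + K + 1 + Kn + K + κ + kn + k + W` with
`W = (K_b − 1)·Room`, and it decodes to `κ`. [folklore] -/
theorem Code_eq (hqD : ∀ l, D.coinLen l ≤ qD.eval l) (n : ℕ) :
    Code D qD d e ℓg n = 1 + (Kof d n + (1 + (Kof d n * n + (Kof d n + (κA D d ℓg n + (kof e n * n + (kof e n +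
      (Kb qD d n (ℓg n) - 1) * Room d e n))))))) ∧
    Code D qD d e ℓg n % Kb qD d n (ℓg n) = κA D d ℓg n := by
  have hKb : 1 ≤ Kb qD d n (ℓg n) := Nat.succ_le_succ (Nat.zero_le _)
  have hκ := κA_lt (d := d) (ℓg := ℓg) hqD n
  constructor
  · unfold Code Room
    obtain ⟨B, hB⟩ : ∃ B, Kb qD d n (ℓg n) = B + 1 := ⟨Kb qD d n (ℓg n) - 1, by omega⟩
    rw [hB, Nat.add_sub_cancel]
    ring
  · unfold Code
    rw [Nat.add_mul_mod_self_left, Nat.mod_eq_of_lt hκ]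

/-! ### The main theorem (modulo the efficiency of the inverter) -/

/-- **The lower bound is inverse polynomial**: with `δ = 1/n^c`, `K = d⌊log₂ n⌋`, `k = kof (c+d) n`,
`δ/(4·2^K·2^k) ≥ 1/n^{3(c+d)+2}` once `n ≥ 2^{2(c+d)+4}`. [folklore] -/
theorem bound_ge {n c d : ℕ} (hn : 1 ≤ n) (hbig : 2 ^ (2 * (c + d) + 4) ≤ n) :
    1 / (n : ℝ) ^ (3 * (c + d) + 2) ≤ 1 / (n : ℝ) ^ c / (4 * 2 ^ Kof d n * 2 ^ kof (c + d) n) := by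
  have hn0 : (0 : ℝ) < n := by exact_mod_cast hn
  have hK : (2 : ℝ) ^ Kof d n ≤ (n : ℝ) ^ d := by exact_mod_cast two_pow_Kof_le hn d
  have hk : (2 : ℝ) ^ kof (c + d) n ≤ 2 ^ (2 * (c + d) + 2) * (n : ℝ) ^ (2 * (c + d) + 1) := by
    exact_mod_cast two_pow_kof_le hn (c + d)
  have hbigR : (2 : ℝ) ^ (2 * (c + d) + 4) ≤ n := by exact_mod_cast hbig
  rw [div_div, div_le_div_iff₀ (by positivity) (by positivity), one_mul, one_mul]
  calc (n : ℝ) ^ c * (4 * 2 ^ Kof d n * 2 ^ kof (c + d) n)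
      ≤ (n : ℝ) ^ c * (4 * (n : ℝ) ^ d * (2 ^ (2 * (c + d) + 2) * (n : ℝ) ^ (2 * (c + d) + 1))) := by gcongr
    _ = 2 ^ (2 * (c + d) + 4) * (n : ℝ) ^ (3 * (c + d) + 1) := by ring
    _ ≤ n * (n : ℝ) ^ (3 * (c + d) + 1) := by gcongr
    _ = (n : ℝ) ^ (3 * (c + d) + 2) := by ring

/-- **The query budget suffices**: `n ≤ 2(δ/2^{K+1})²(2^k − 1)` for `δ = 1/n^c`, `k = kof (c+d) n`. [folklore] -/
theorem queries_ge {n c d : ℕ} (hn : 1 ≤ n) :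
    (n : ℝ) ≤ 2 * (1 / (n : ℝ) ^ c / 2 ^ Kof d n / 2) ^ 2 * (2 ^ kof (c + d) n - 1 : ℕ) := by
  have hn0 : (0 : ℝ) < n := by exact_mod_cast hn
  have hK : (2 : ℝ) ^ Kof d n ≤ (n : ℝ) ^ d := by exact_mod_cast two_pow_Kof_le hn d
  have hq : 2 * (n : ℝ) ^ (2 * (c + d) + 1) ≤ (2 ^ kof (c + d) n - 1 : ℕ) := by
    exact_mod_cast two_mul_pow_le_two_pow_kof (c + d) n
  have hε : 1 / (2 * (n : ℝ) ^ (c + d)) ≤ 1 / (n : ℝ) ^ c / 2 ^ Kof d n / 2 := by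
    rw [div_div, div_div, div_le_div_iff₀ (by positivity) (by positivity), one_mul, one_mul, pow_add]
    nlinarith [pow_pos hn0 c]
  have hε0 : (0 : ℝ) ≤ 1 / (2 * (n : ℝ) ^ (c + d)) := by positivity
  calc (n : ℝ) = 2 * (1 / (2 * (n : ℝ) ^ (c + d))) ^ 2 * (2 * (n : ℝ) ^ (2 * (c + d) + 1)) := by
        field_simp; ring
    _ ≤ 2 * (1 / (n : ℝ) ^ c / 2 ^ Kof d n / 2) ^ 2 * (2 ^ kof (c + d) n - 1 : ℕ) := by gcongr

/-- **The Goldreich–Levin theorem for hiding functions of fixed output length, modulo the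
efficiency of the inverter.** [cite: LiuPassFOCS2020, Appendix (Thm [GL89], hardcore functions for S-hiding f)] -/
theorem goldreichLevin_hiding_len_of_eff (heff : glInvRun_polyTime) : goldreichLevin_hiding_len := by
  intro S g m d ℓg hlen hne hhid D hD
  by_contra hneg
  obtain ⟨c, hfreq⟩ := exists_frequently_ge_of_not_superpolynomialDecay' (fun n => distAdvantage_nonneg D _ _ n) hneg
  obtain ⟨qD, hqD⟩ := hD.2
  -- good levels
  set Gs : ℕ → Prop := fun n => 1 / (n : ℝ) ^ c ≤ distAdvantage D (glRealEns g S m d) (glIdealEns g S m d) n ∧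
    2 ^ (2 * (c + d) + 4) ≤ n ∧ (S n).Nonempty with hGs
  have hGsf : ∃ᶠ n in atTop, Gs n := hfreq.and_eventually ((eventually_ge_atTop _).and hne)
  have hG' : ∀ a, ∃ b, a ≤ b ∧ Gs b := fun a => by
    obtain ⟨b, hb, hGb⟩ := frequently_atTop.1 hGsf a
    exact ⟨b, hb, hGb⟩
  -- the inverter with the advice-carrying coin budget is PPT
  set A' := alg D qD d (c + d) (clGL D qD d (c + d) ℓg Gs) with hA'
  have hPPT : IsPPT A' id := by
    refine ⟨?_, ⟨clPolyGL qD d (c + d), clGL_le hqD hG' (fun n hn => le_trans Nat.one_le_two_pow hn.2.1)⟩⟩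
    obtain ⟨p, M, hM⟩ := heff D qD d (c + d) hD
    exact ⟨p, M, fun a => hM a⟩
  -- hiding: eventually `< 1/n^{3(c+d)+2}`
  have hev : ∀ᶠ n : ℕ in atTop, hidingProb g A' S m n < 1 / (n : ℝ) ^ (3 * (c + d) + 2) :=
    (isNegligible_iff_eventually_lt_of_nonneg (fun n => hidingProb_nonneg g A' S m n)).1 (hhid A' hPPT) _
  obtain ⟨N₁, hN₁⟩ := eventually_atTop.1 hev
  set n := Yao.seqN Gs (wlen ℓg) N₁ with hn
  have hNn : N₁ ≤ n := (Yao.seqN_strictMono hG' wlen_ge).id_le N₁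
  obtain ⟨hgood, hbig, hSn⟩ := Yao.seqN_good (w := wlen ℓg) hG' N₁
  have hn1 : 1 ≤ n := le_trans Nat.one_le_two_pow hbig
  -- the counting bound at `n`
  obtain ⟨hCode, hmod⟩ := Code_eq (D := D) (qD := qD) (d := d) (e := c + d) (ℓg := ℓg) hqD n
  have hmain := hidingProb_ge D qD d (c + d) g S m (ℓ := ℓg n) (κ := κA D d ℓg n)
    (W := (Kb qD d n (ℓg n) - 1) * Room d (c + d) n) (clGL D qD d (c + d) ℓg Gs) (δ := 1 / (n : ℝ) ^ c)
    hSn (fun x hx ρ => hlen n x ρ.toList hx (List.Vector.toList_length ρ)) rfl (by rw [← hCode]; exact hmod)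
    (by rw [← hCode]; exact clGL_eq hG' N₁) (by unfold kof; omega) (by positivity) hgood (queries_ge hn1)
  have h1 := hN₁ n hNn
  have h2 := bound_ge (c := c) (d := d) hn1 hbig
  linarith

end GLInv

end Literature.Computability.Cryptography
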